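import Summits.Ventures.LatticeQCDFlow.Scoring.PlaquetteAngleSecondMomentWeakCoupling
import Literature.Probability.LatticeModels.BesselIDebyeAsymptotics
import HarnessLib

/-!
# The characteristic function of one plaquette angle: Taylor sandwich, normalisation and tail bounds

HONEST FRAMING: exact (Metropolis-corrected) sampling algorithms for lattice gauge theory;
figures of merit are autocorrelation/cost numbers at stated couplings and volumes; no
continuum-physics claim.

Venture `LatticeQCDFlow` (cell pub-lqcd), sub-topic `Scoring`; FANOUT row 5 (`s0-sun-a`), GEN-15.
NEW WORK of the cell (placement rule).  The law of theory-2's topological charge `Q` of 2-d `U(1)`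
on the `L × L` torus is `P(Q = k) = g_V(2πk)/Σ_j g_V(2πj)` with
`g_V(2πk) = (1/2π) ∫_ℝ e^{−it·2πk} F_β(t)^V dt`, `F_β(t) = ∫_{−π}^{π} e^{itθ} e^{−β(1−cos θ)} dθ`
(`Scoring/U1SectorWeightFourier.lean`), i.e. `Q` is the sum of `V = L²` i.i.d. plaquette angles
read modulo its density at the lattice `2πℤ`.  Its continuum limit (`β, V → ∞`, `V/β → v`) is a
local central limit theorem for the angle law `∝ e^{β cos θ}` on `[−π, π]`, whose inputs are bounds
on the (real, even) characteristic function
`φ_β(t) = C_β(t)/Z(β)`, `C_β(t) = ∫_{−π}^{π} cos(tθ) e^{β cos θ} dθ`, `Z(β) = ∫_{−π}^{π} e^{β cos θ} dθ`.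
This file:

* **Taylor sandwich** — `Z − (t²/2) M₂ ≤ C_β(t) ≤ Z − (t²/2) M₂ + (t⁴/24) M₄`
  (`M_k = ∫ θ^k e^{β cos θ}`; `1 − x²/2 ≤ cos x ≤ 1 − x²/2 + x⁴/24`, the latter from
  `Literature/Probability/LatticeModels/BesselIDebyeAsymptotics.lean`), `|C_β(t)| ≤ Z`;
* **normalisation from above** — `Z(β) ≤ e^β √(π³/(2β))` (`β > 0`; Gaussian domination), to go
  with `Z(β) ≥ (5/3) e^β/√β` of `Scoring/PlaquetteAngleMomentBounds.lean`;
* **window second moment** — `∫_{−a}^{a} θ² e^{β cos θ} dθ ≥ e^β (2a³/3 − β a⁵/5)` and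
  `∫_{−a}^{a} e^{β cos θ} dθ ≥ e^β (2a − β a³/3)` (`0 ≤ a ≤ π`);
* **tail bound** — `|C_β(t)| ≤ 2 e^β/|t|` (`t ≠ 0`, `β > 0`; one integration by parts, total
  variation `2(e^β − e^{−β})` of the weight plus the boundary `2e^{−β}`), hence
  **`|φ_β(t)| ≤ (6/5) √β/|t|`** for `β ≥ 1`.

The window bound `|φ_β(t)| ≤ 1 − κ t²/β` (`|t| ≤ 2√β`) is `Scoring/U1PlaquetteCharFunWindow.lean`.
Elementary; nothing is cited.  No sampler values.
-/

noncomputable section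

open Real MeasureTheory Set Filter Topology intervalIntegral
open Literature.Analysis.FunctionSpaces

namespace Summit.Ventures.LatticeQCDFlow.Scoring

/-! ### 1. The Taylor sandwich -/

/-- **Lower Taylor bound**: `Z(β) − (t²/2) M₂(β) ≤ C_β(t)`. -/
theorem integral_cos_mul_mul_exp_ge (β t : ℝ) :
    (∫ v in (-π)..π, Real.exp (β * Real.cos v)) -
        t ^ 2 / 2 * ∫ v in (-π)..π, v ^ 2 * Real.exp (β * Real.cos v) ≤
      ∫ v in (-π)..π, Real.cos (t * v) * Real.exp (β * Real.cos v) := by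
  have hle : -π ≤ π := by linarith [Real.pi_pos]
  have hc1 : Continuous fun v => Real.exp (β * Real.cos v) := by fun_prop
  have hc2 : Continuous fun v => t ^ 2 / 2 * (v ^ 2 * Real.exp (β * Real.cos v)) := by fun_prop
  rw [← intervalIntegral.integral_const_mul, ← intervalIntegral.integral_sub (hc1.intervalIntegrable _ _)
    (hc2.intervalIntegrable _ _)]
  refine intervalIntegral.integral_mono_on hle ((hc1.sub hc2).intervalIntegrable _ _) ?_ fun v _ => ?_
  · exact (by fun_prop : Continuous fun v => Real.cos (t * v) * Real.exp (β * Real.cos v))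
      |>.intervalIntegrable _ _
  · have h := Real.one_sub_sq_div_two_le_cos (x := t * v)
    have hw := Real.exp_pos (β * Real.cos v)
    nlinarith [mul_le_mul_of_nonneg_right h hw.le]

/-- **Upper Taylor bound**: `C_β(t) ≤ Z(β) − (t²/2) M₂(β) + (t⁴/24) M₄(β)`. -/
theorem integral_cos_mul_mul_exp_le (β t : ℝ) :
    ∫ v in (-π)..π, Real.cos (t * v) * Real.exp (β * Real.cos v) ≤
      (∫ v in (-π)..π, Real.exp (β * Real.cos v)) -
        t ^ 2 / 2 * (∫ v in (-π)..π, v ^ 2 * Real.exp (β * Real.cos v)) +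
        t ^ 4 / 24 * ∫ v in (-π)..π, v ^ 4 * Real.exp (β * Real.cos v) := by
  have hle : -π ≤ π := by linarith [Real.pi_pos]
  have hc1 : Continuous fun v => Real.exp (β * Real.cos v) := by fun_prop
  have hc2 : Continuous fun v => t ^ 2 / 2 * (v ^ 2 * Real.exp (β * Real.cos v)) := by fun_prop
  have hc4 : Continuous fun v => t ^ 4 / 24 * (v ^ 4 * Real.exp (β * Real.cos v)) := by fun_prop
  have key : ∫ v in (-π)..π, Real.cos (t * v) * Real.exp (β * Real.cos v) ≤
      ∫ v in (-π)..π, (Real.exp (β * Real.cos v) - t ^ 2 / 2 * (v ^ 2 * Real.exp (β * Real.cos v)) +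
        t ^ 4 / 24 * (v ^ 4 * Real.exp (β * Real.cos v))) := by
    refine intervalIntegral.integral_mono_on hle ?_ (((hc1.sub hc2).add hc4).intervalIntegrable _ _)
      fun v _ => ?_
    · exact (by fun_prop : Continuous fun v => Real.cos (t * v) * Real.exp (β * Real.cos v))
        |>.intervalIntegrable _ _
    · have h := Literature.Probability.LatticeModels.cos_le_one_sub_sq_half_add_fourth (t * v)
      have hw := Real.exp_pos (β * Real.cos v)
      nlinarith [mul_le_mul_of_nonneg_right h hw.le]
  rw [intervalIntegral.integral_add (f := fun v => Real.exp (β * Real.cos v) -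
      t ^ 2 / 2 * (v ^ 2 * Real.exp (β * Real.cos v)))
      (g := fun v => t ^ 4 / 24 * (v ^ 4 * Real.exp (β * Real.cos v)))
      ((hc1.sub hc2).intervalIntegrable _ _) (hc4.intervalIntegrable _ _),
    intervalIntegral.integral_sub (f := fun v => Real.exp (β * Real.cos v))
      (g := fun v => t ^ 2 / 2 * (v ^ 2 * Real.exp (β * Real.cos v)))
      (hc1.intervalIntegrable _ _) (hc2.intervalIntegrable _ _),
    intervalIntegral.integral_const_mul, intervalIntegral.integral_const_mul] at key
  exact key

/-- `|C_β(t)| ≤ Z(β)` (`|cos| ≤ 1`). -/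
theorem abs_integral_cos_mul_mul_exp_le (β t : ℝ) :
    |∫ v in (-π)..π, Real.cos (t * v) * Real.exp (β * Real.cos v)| ≤
      ∫ v in (-π)..π, Real.exp (β * Real.cos v) := by
  have hle : -π ≤ π := by linarith [Real.pi_pos]
  refine (intervalIntegral.abs_integral_le_integral_abs hle).trans ?_
  refine intervalIntegral.integral_mono_on hle ?_ ?_ fun v _ => ?_
  · exact (by fun_prop : Continuous fun v => |Real.cos (t * v) * Real.exp (β * Real.cos v)|)
      |>.intervalIntegrable _ _
  · exact (by fun_prop : Continuous fun v => Real.exp (β * Real.cos v)).intervalIntegrable _ _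
  · rw [abs_mul, abs_of_pos (Real.exp_pos _)]
    exact mul_le_of_le_one_left (Real.exp_pos _).le (Real.abs_cos_le_one _)

/-! ### 2. Normalisation from above and window integrals from below -/

/-- **`Z(β) ≤ e^β √(π³/(2β))`** for `β > 0` (`cos v ≤ 1 − 2v²/π²` on `[−π, π]` and the Gaussian
integral). -/
theorem integral_exp_mul_cos_neg_pi_pi_le {β : ℝ} (hβ : 0 < β) :
    ∫ v in (-π)..π, Real.exp (β * Real.cos v) ≤ Real.exp β * Real.sqrt (π ^ 3 / (2 * β)) := by
  have hπ : 0 < π := Real.pi_pos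
  have hle : -π ≤ π := by linarith
  have hc : 0 < 2 * β / π ^ 2 := by positivity
  have h1 : ∫ v in (-π)..π, Real.exp (β * Real.cos v) ≤
      ∫ v in (-π)..π, Real.exp β * Real.exp (-(2 * β / π ^ 2 * v ^ 2)) := by
    refine intervalIntegral.integral_mono_on hle ?_ ?_ fun v hv => ?_
    · exact (by fun_prop : Continuous fun v => Real.exp (β * Real.cos v)).intervalIntegrable _ _
    · exact (by fun_prop : Continuous fun v => Real.exp β * Real.exp (-(2 * β / π ^ 2 * v ^ 2)))
        |>.intervalIntegrable _ _
    · rw [← Real.exp_add]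
      refine Real.exp_le_exp.2 ?_
      have habs : |v| ≤ π := abs_le.2 ⟨hv.1, hv.2⟩
      have hcos := mul_le_mul_of_nonneg_left (Real.cos_le_one_sub_mul_cos_sq habs) hβ.le
      have e : β * (1 - 2 / π ^ 2 * v ^ 2) = β + -(2 * β / π ^ 2 * v ^ 2) := by ring
      linarith
  refine h1.trans ?_
  rw [intervalIntegral.integral_const_mul]
  refine mul_le_mul_of_nonneg_left ?_ (Real.exp_pos _).le
  have h2 := integral_exp_neg_mul_sq_neg_pi_pi_le hc
  have e : π / (2 * β / π ^ 2) = π ^ 3 / (2 * β) := by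
    field_simp
  rwa [e] at h2

/-- **Window second moment from below**: for `0 ≤ a`,
`∫_{−a}^{a} v² e^{β cos v} dv ≥ e^β (2a³/3 − β a⁵/5)` (`β ≥ 0`; `e^{β cos v} ≥ e^β (1 − βv²/2)`). -/
theorem integral_sq_mul_exp_window_ge {β : ℝ} (hβ : 0 ≤ β) {a : ℝ} (ha : 0 ≤ a) :
    Real.exp β * (2 * a ^ 3 / 3 - β * a ^ 5 / 5) ≤
      ∫ v in (-a)..a, v ^ 2 * Real.exp (β * Real.cos v) := by
  have hle : -a ≤ a := by linarith
  have hpoly : ∫ v in (-a)..a, Real.exp β * (v ^ 2 - β * v ^ 4 / 2) ≤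
      ∫ v in (-a)..a, v ^ 2 * Real.exp (β * Real.cos v) := by
    refine intervalIntegral.integral_mono_on hle ?_ ?_ fun v _ => ?_
    · exact (by fun_prop : Continuous fun v => Real.exp β * (v ^ 2 - β * v ^ 4 / 2)).intervalIntegrable _ _
    · exact (by fun_prop : Continuous fun v => v ^ 2 * Real.exp (β * Real.cos v)).intervalIntegrable _ _
    · have hcos : 1 - v ^ 2 / 2 ≤ Real.cos v := Real.one_sub_sq_div_two_le_cos
      have h1 : Real.exp β * Real.exp (-(β * v ^ 2 / 2)) ≤ Real.exp (β * Real.cos v) := by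
        rw [← Real.exp_add]
        exact Real.exp_le_exp.2 (by nlinarith [mul_le_mul_of_nonneg_left hcos hβ])
      have h2 : 1 - β * v ^ 2 / 2 ≤ Real.exp (-(β * v ^ 2 / 2)) := by
        linarith [Real.add_one_le_exp (-(β * v ^ 2 / 2))]
      have hv2 : 0 ≤ v ^ 2 := sq_nonneg v
      calc Real.exp β * (v ^ 2 - β * v ^ 4 / 2) = v ^ 2 * (Real.exp β * (1 - β * v ^ 2 / 2)) := by ring
        _ ≤ v ^ 2 * (Real.exp β * Real.exp (-(β * v ^ 2 / 2))) :=
            mul_le_mul_of_nonneg_left (mul_le_mul_of_nonneg_left h2 (Real.exp_pos β).le) hv2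
        _ ≤ v ^ 2 * Real.exp (β * Real.cos v) := mul_le_mul_of_nonneg_left h1 hv2
  refine le_trans (le_of_eq ?_) hpoly
  have hd : ∀ v : ℝ, HasDerivAt (fun x : ℝ => Real.exp β * (x ^ 3 / 3 - β * x ^ 5 / 10))
      (Real.exp β * (v ^ 2 - β * v ^ 4 / 2)) v := fun v => by
    have h := (((hasDerivAt_pow 3 v).div_const 3).sub
      (((hasDerivAt_pow 5 v).const_mul β).div_const 10)).const_mul (Real.exp β)
    refine h.congr_deriv ?_
    push_cast; ring
  rw [integral_eq_sub_of_hasDerivAt (fun v _ => hd v)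
    ((by fun_prop : Continuous fun v => Real.exp β * (v ^ 2 - β * v ^ 4 / 2)).intervalIntegrable _ _)]
  ring

/-- **Window mass from below**: for `0 ≤ a`, `β ≥ 0`: `∫_{−a}^{a} e^{β cos v} dv ≥ e^β (2a − β a³/3)`. -/
theorem integral_exp_window_ge {β : ℝ} (hβ : 0 ≤ β) {a : ℝ} (ha : 0 ≤ a) :
    Real.exp β * (2 * a - β * a ^ 3 / 3) ≤ ∫ v in (-a)..a, Real.exp (β * Real.cos v) := by
  have hle : -a ≤ a := by linarith
  have hpoly : ∫ v in (-a)..a, Real.exp β * (1 - β * v ^ 2 / 2) ≤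
      ∫ v in (-a)..a, Real.exp (β * Real.cos v) := by
    refine intervalIntegral.integral_mono_on hle ?_ ?_ fun v _ => ?_
    · exact (by fun_prop : Continuous fun v => Real.exp β * (1 - β * v ^ 2 / 2)).intervalIntegrable _ _
    · exact (by fun_prop : Continuous fun v => Real.exp (β * Real.cos v)).intervalIntegrable _ _
    · have hcos : 1 - v ^ 2 / 2 ≤ Real.cos v := Real.one_sub_sq_div_two_le_cos
      have h1 : Real.exp β * Real.exp (-(β * v ^ 2 / 2)) ≤ Real.exp (β * Real.cos v) := by
        rw [← Real.exp_add]
        exact Real.exp_le_exp.2 (by nlinarith [mul_le_mul_of_nonneg_left hcos hβ])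
      have h2 : 1 - β * v ^ 2 / 2 ≤ Real.exp (-(β * v ^ 2 / 2)) := by
        linarith [Real.add_one_le_exp (-(β * v ^ 2 / 2))]
      exact (mul_le_mul_of_nonneg_left h2 (Real.exp_pos β).le).trans h1
  refine le_trans (le_of_eq ?_) hpoly
  have hd : ∀ v : ℝ, HasDerivAt (fun x : ℝ => Real.exp β * (x - β * x ^ 3 / 6))
      (Real.exp β * (1 - β * v ^ 2 / 2)) v := fun v => by
    have h := ((hasDerivAt_id' v).sub (((hasDerivAt_pow 3 v).const_mul β).div_const 6)).const_mul
      (Real.exp β)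
    refine h.congr_deriv ?_
    push_cast; ring
  rw [integral_eq_sub_of_hasDerivAt (fun v _ => hd v)
    ((by fun_prop : Continuous fun v => Real.exp β * (1 - β * v ^ 2 / 2)).intervalIntegrable _ _)]
  ring

/-! ### 3. The tail bound -/

/-- `∫_0^π sin v · e^{β cos v} dv = (e^β − e^{−β})/β` (`β ≠ 0`). -/
theorem integral_sin_mul_exp_zero_pi {β : ℝ} (hβ : β ≠ 0) :
    ∫ v in (0 : ℝ)..π, Real.sin v * Real.exp (β * Real.cos v) = (Real.exp β - Real.exp (-β)) / β := by
  have hd : ∀ v : ℝ, HasDerivAt (fun x : ℝ => -Real.exp (β * Real.cos x) / β)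
      (Real.sin v * Real.exp (β * Real.cos v)) v := fun v => by
    have h := (((Real.hasDerivAt_cos v).const_mul β).exp.neg).div_const β
    refine h.congr_deriv ?_
    field_simp
  rw [integral_eq_sub_of_hasDerivAt (fun v _ => hd v)
    ((by fun_prop : Continuous fun v => Real.sin v * Real.exp (β * Real.cos v)).intervalIntegrable _ _)]
  simp only [Real.cos_pi, Real.cos_zero, mul_neg, mul_one]
  ring

/-- `|∫_{−π}^{π} sin(tv) sin v · e^{β cos v} dv| ≤ 2(e^β − e^{−β})/β` (`β > 0`). -/
theorem abs_integral_sin_mul_sin_mul_exp_le {β : ℝ} (hβ : 0 < β) (t : ℝ) :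
    |∫ v in (-π)..π, Real.sin (t * v) * Real.sin v * Real.exp (β * Real.cos v)| ≤
      2 * ((Real.exp β - Real.exp (-β)) / β) := by
  have hπ : 0 < π := Real.pi_pos
  set f : ℝ → ℝ := fun v => Real.sin (t * v) * Real.sin v * Real.exp (β * Real.cos v) with hf
  have hfc : Continuous f := by rw [hf]; fun_prop
  have hgc : Continuous fun v => Real.sin v * Real.exp (β * Real.cos v) := by fun_prop
  -- split at `0`
  rw [← intervalIntegral.integral_add_adjacent_intervals (hfc.intervalIntegrable (-π) 0)
    (hfc.intervalIntegrable 0 π)]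
  -- on `[0, π]`: `|f| ≤ sin v e^{β cos v}`
  have hpos : |∫ v in (0 : ℝ)..π, f v| ≤ (Real.exp β - Real.exp (-β)) / β := by
    rw [← integral_sin_mul_exp_zero_pi hβ.ne']
    refine (intervalIntegral.abs_integral_le_integral_abs hπ.le).trans ?_
    refine intervalIntegral.integral_mono_on hπ.le (hfc.abs.intervalIntegrable _ _)
      (hgc.intervalIntegrable _ _) fun v hv => ?_
    rw [hf]
    simp only
    rw [abs_mul, abs_mul, abs_of_pos (Real.exp_pos _), abs_of_nonneg (Real.sin_nonneg_of_mem_Icc hv)]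
    have := Real.abs_sin_le_one (t * v)
    have hs := Real.sin_nonneg_of_mem_Icc hv
    have hw := (Real.exp_pos (β * Real.cos v)).le
    calc |Real.sin (t * v)| * Real.sin v * Real.exp (β * Real.cos v)
        ≤ 1 * Real.sin v * Real.exp (β * Real.cos v) := by gcongr
      _ = _ := by ring
  -- on `[−π, 0]`: reflect
  have hneg : |∫ v in (-π)..0, f v| ≤ (Real.exp β - Real.exp (-β)) / β := by
    have hrefl : ∫ v in (-π)..0, f v = ∫ v in (0 : ℝ)..π, f (-v) := by
      rw [intervalIntegral.integral_comp_neg]; simp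
    have hfn : ∀ v, f (-v) = f v := fun v => by
      rw [hf]; simp only [mul_neg, Real.sin_neg, Real.cos_neg]; ring
    rw [hrefl]
    simp only [hfn]
    exact hpos
  calc |(∫ v in (-π)..0, f v) + ∫ v in (0 : ℝ)..π, f v|
      ≤ |∫ v in (-π)..0, f v| + |∫ v in (0 : ℝ)..π, f v| := abs_add_le _ _
    _ ≤ _ := by linarith

/-- **The tail bound**: `|C_β(t)| ≤ 2 e^β/|t|` for `t ≠ 0`, `β > 0` (integration by parts with
`F = sin(tv)/t`: `C_β(t) = 2 sin(tπ) e^{−β}/t + (β/t) ∫ sin(tv) sin v e^{β cos v} dv`). -/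
theorem abs_integral_cos_mul_mul_exp_le_div {β : ℝ} (hβ : 0 < β) {t : ℝ} (ht : t ≠ 0) :
    |∫ v in (-π)..π, Real.cos (t * v) * Real.exp (β * Real.cos v)| ≤ 2 * Real.exp β / |t| := by
  have hd : ∀ v : ℝ, HasDerivAt (fun x : ℝ => Real.sin (t * x) / t) (Real.cos (t * v)) v := fun v => by
    have h := ((Real.hasDerivAt_sin (t * v)).comp v ((hasDerivAt_id' v).const_mul t)).div_const t
    refine h.congr_deriv ?_
    field_simp
  have hparts := integral_deriv_mul_exp_mul_cos β hd (by fun_prop)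
  rw [hparts]
  have hI : ∫ v in (-π)..π, Real.sin (t * v) / t * Real.sin v * Real.exp (β * Real.cos v) =
      (∫ v in (-π)..π, Real.sin (t * v) * Real.sin v * Real.exp (β * Real.cos v)) / t := by
    rw [← intervalIntegral.integral_div]
    refine intervalIntegral.integral_congr fun v _ => ?_
    ring
  rw [hI]
  have hS := abs_integral_sin_mul_sin_mul_exp_le hβ t
  have hb : |(Real.sin (t * π) / t - Real.sin (t * -π) / t) * Real.exp (-β)| ≤ 2 * Real.exp (-β) / |t| := by
    rw [abs_mul, abs_of_pos (Real.exp_pos _), mul_neg, Real.sin_neg, neg_div, sub_neg_eq_add, ← two_mul,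
      abs_mul, abs_div, abs_two]
    have := Real.abs_sin_le_one (t * π)
    rw [div_eq_mul_inv, div_eq_mul_inv]
    calc 2 * (|Real.sin (t * π)| * |t|⁻¹) * Real.exp (-β) ≤ 2 * (1 * |t|⁻¹) * Real.exp (-β) := by gcongr
      _ = 2 * Real.exp (-β) * |t|⁻¹ := by ring
  have hm : |β * ((∫ v in (-π)..π, Real.sin (t * v) * Real.sin v * Real.exp (β * Real.cos v)) / t)| ≤
      2 * (Real.exp β - Real.exp (-β)) / |t| := by
    rw [abs_mul, abs_of_pos hβ, abs_div]
    rw [mul_div_assoc', div_le_div_iff_of_pos_right (abs_pos.2 ht)]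
    have := mul_le_mul_of_nonneg_left hS hβ.le
    have e : β * (2 * ((Real.exp β - Real.exp (-β)) / β)) = 2 * (Real.exp β - Real.exp (-β)) := by
      field_simp
    linarith
  calc |(Real.sin (t * π) / t - Real.sin (t * -π) / t) * Real.exp (-β) +
        β * ((∫ v in (-π)..π, Real.sin (t * v) * Real.sin v * Real.exp (β * Real.cos v)) / t)|
      ≤ |(Real.sin (t * π) / t - Real.sin (t * -π) / t) * Real.exp (-β)| +
        |β * ((∫ v in (-π)..π, Real.sin (t * v) * Real.sin v * Real.exp (β * Real.cos v)) / t)| :=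
        abs_add_le _ _
    _ ≤ 2 * Real.exp (-β) / |t| + 2 * (Real.exp β - Real.exp (-β)) / |t| := add_le_add hb hm
    _ = 2 * Real.exp β / |t| := by ring

/-- **The tail bound for the characteristic function**: `|φ_β(t)| ≤ (6/5) √β/|t|` for `β ≥ 1`,
`t ≠ 0` (with `Z(β) ≥ (5/3) e^β/√β`). -/
theorem abs_charFun_le_tail {β : ℝ} (hβ : 1 ≤ β) {t : ℝ} (ht : t ≠ 0) :
    |(∫ v in (-π)..π, Real.cos (t * v) * Real.exp (β * Real.cos v)) /
        (∫ v in (-π)..π, Real.exp (β * Real.cos v))| ≤ 6 / 5 * Real.sqrt β / |t| := by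
  have hβ0 : 0 < β := by linarith
  have hZ := integral_exp_mul_cos_neg_pi_pi_pos β
  have hZge := integral_exp_mul_cos_neg_pi_pi_ge hβ
  have hC := abs_integral_cos_mul_mul_exp_le_div hβ0 ht
  have hsq : 0 < Real.sqrt β := Real.sqrt_pos.2 hβ0
  have htabs : 0 < |t| := abs_pos.2 ht
  rw [abs_div, abs_of_pos hZ, div_le_iff₀ hZ]
  refine hC.trans ?_
  -- `2 e^β/|t| ≤ (6/5)√β/|t| · Z` since `Z ≥ (5/3) e^β/√β`
  have h1 : 6 / 5 * Real.sqrt β / |t| * (5 / 3 * Real.exp β / Real.sqrt β) = 2 * Real.exp β / |t| := by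
    field_simp
    ring
  rw [← h1]
  exact mul_le_mul_of_nonneg_left hZge (by positivity)

end Summit.Ventures.LatticeQCDFlow.Scoring
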